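import Summits.Ventures.PercRepro.Night2FatFaceCap
import Summits.Ventures.PercRepro.Night2FatFaceInj
import Summits.Ventures.PercRepro.Night2ThreeOneFatSums
import Summits.Ventures.PercRepro.Night2SeriesClassesThreeOneFS

/-!
# PercRepro — the `(3, 1)` survivor cells close with the fat-face capacity (night-2, gen 24)

`localShadowHall_three_one_five_of_classes_fat`: the generic series-class cell `(3, 1)` at `n = |G ∖ K|` with the
chord excess of gen 20 and the middle-target capacity `cPrimeFat 5 3 5 1 f` (`Night2FatFaceCap`) — (LI_G) from
pairwise disjoint classes of 2-cocircuits, a positive count, «every middle target has `≤ f` fat thin covering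
preimages» and a count sum `≥ 1`.  `three_one_fat_data` packs the chord constants of `n = 10 … 14` with the fifteen
count sums of `Night2ThreeOneFatSums`.  The three configurations of the survivors:

* **`localShadowHall_three_one_five_of_onePair_fat`** — one fat thin closure (`f = 1`, class `[2]`);
* **`localShadowHall_three_one_five_of_twoDisjoint_fat`** — two fat thin closures with disjoint missed pairs
  (`f = 2`, class `[2, 2]`);
* **`localShadowHall_three_one_five_of_triangle_fat`** — a triangle of 2-cocircuits with `≤ 2` fat preimages per
  middle target (`f = 2`, class `[3]`; the bound `≤ 2` comes from `Night2FatFaceInj` in both the two-closure and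
  the three-closure case).

All at `11 ≤ |G| ≤ 15`, the whole surviving range of the cell.
-/

namespace PercRepro.Shadow

open Finset PerFlat ThmH

/-- **The chord data of the `(3, 1)` cells `n = 10 … 14`** with the three fat count sums: the chord `(a, b)` of
`1/(m + 3)` on `[2, n − 4]`, the excess `E = excessBound 5 3 5 1 n a b > 0`, and the count sums of `[2]` (`f = 1`),
`[2, 2]` and `[3]` (`f = 2`) at `E`. -/
theorem three_one_fat_data : ∀ n : ℕ, 10 ≤ n → n ≤ 14 → ∃ a b E : ℚ, 0 ≤ b ∧
    (∀ m : ℕ, 2 ≤ m → m ≤ n - 5 + 1 → 1 / ((m : ℚ) + ((3 : ℕ) : ℚ)) ≤ a - b * (m : ℚ)) ∧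
    excessBound 5 3 5 1 n a b = E ∧ 0 < E ∧
    1 ≤ countSum n 5 3 (cPrimeFat 5 3 5 1 1) E (fun s => (cntSeries 5 s [2] : ℚ)) ∧
    1 ≤ countSum n 5 3 (cPrimeFat 5 3 5 1 2) E (fun s => (cntSeries 5 s [2, 2] : ℚ)) ∧
    1 ≤ countSum n 5 3 (cPrimeFat 5 3 5 1 2) E (fun s => (cntSeries 5 s [3] : ℚ)) := by
  intro n h1 h2
  interval_cases n
  · exact ⟨11 / 45, 1 / 45, 71 / 216, by norm_num, fun m hm1 hm2 => DGenP.chord_three_one_10 m hm1 (by omega),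
      DGenP.excessBound_three_one_10, by norm_num, countSum_three_one_ten_2_fat1, countSum_three_one_ten_22_fat2,
      countSum_three_one_ten_3_fat2⟩
  · exact ⟨6 / 25, 1 / 50, 59 / 200, by norm_num, fun m hm1 hm2 => DGenP.chord_three_one_11 m hm1 (by omega),
      DGenP.excessBound_three_one_11, by norm_num, countSum_three_one_eleven_2_fat1,
      countSum_three_one_eleven_22_fat2, countSum_three_one_eleven_3_fat2⟩
  · exact ⟨13 / 55, 1 / 55, 353 / 1320, by norm_num, fun m hm1 hm2 => DGenP.chord_three_one_12 m hm1 (by omega),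
      DGenP.excessBound_three_one_12, by norm_num, countSum_three_one_twelve_2_fat1,
      countSum_three_one_twelve_22_fat2, countSum_three_one_twelve_3_fat2⟩
  · exact ⟨7 / 30, 1 / 60, 11 / 45, by norm_num, fun m hm1 hm2 => DGenP.chord_three_one_13 m hm1 (by omega),
      DGenP.excessBound_three_one_13, by norm_num, countSum_three_one_thirteen_2_fat1,
      countSum_three_one_thirteen_22_fat2, countSum_three_one_thirteen_3_fat2⟩
  · exact ⟨3 / 13, 1 / 65, 9 / 40, by norm_num, fun m hm1 hm2 => DGenP.chord_three_one_14 m hm1 (by omega),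
      DGenP.excessBound_three_one_14, by norm_num, countSum_three_one_fourteen_2_fat1,
      countSum_three_one_fourteen_22_fat2, countSum_three_one_fourteen_3_fat2⟩

variable {α : Type*} [DecidableEq α] {M : Matroid α} [M.Finite]

open scoped Classical in
/-- **The generic series-class cell `(3, 1)` with the fat-face capacity**: at `n = |G ∖ K|` with the chord `(a, b)`
and the excess `E`, pairwise disjoint nonempty classes of 2-cocircuits, a positive count, `≤ f` fat thin covering
preimages at every middle target and a count sum `≥ 1` (with `cPrimeFat 5 3 5 1 f`) give (LI_G). -/
theorem localShadowHall_three_one_five_of_classes_fat {G : Finset α} (hG : G ∈ flatsQ M (5 + 1))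
    (hd : (gr M \ G).card = 3) (hk : kColoops M G = 1)
    (hs : ∀ e ∈ gr M, ∀ f ∈ gr M, e ≠ f → rkN M {e, f} = 2) (hl : ∀ e ∈ gr M, M.Indep {e})
    {n : ℕ} (hn : G.card = n + 1) (Cs : List (Finset α)) (hpw : Cs.Pairwise Disjoint) (hsz : ∀ C ∈ Cs, 1 ≤ C.card)
    (hcoc : ∀ C ∈ Cs, ∀ a ∈ C, ∀ b ∈ C, a ≠ b →
      coloops M G ⊆ G \ {a, b} ∧ M.eRk ((G \ {a, b} : Finset α) : Set α) ≤ ((5 : ℕ) : ℕ∞))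
    {f : ℕ} (hcf : 0 ≤ cPrimeFat 5 3 5 1 f)
    (hfat : ∀ S ∈ shadowAt M (5 + 2) 5 (Uq M (5 + 2) 5) G, 5 + 1 ≤ (S \ coloops M G).card →
      ((coverPreimages M (Uq M (5 + 2) 5) G S).filter
        (fun B => B ∉ lay0 M 5 G ∧ (G \ clF M B).card ≤ 2)).card ≤ f)
    {a b E : ℚ} (hb : 0 ≤ b)
    (hchord : ∀ m : ℕ, 2 ≤ m → m ≤ n - 5 + 1 → 1 / ((m : ℚ) + ((3 : ℕ) : ℚ)) ≤ a - b * (m : ℚ))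
    (hEeq : excessBound 5 3 5 1 n a b = E) (hE : 0 < E)
    (hpos : ∀ s, 6 ≤ s → s ≤ n → 0 < (cntSeries 5 s (Cs.map Finset.card) : ℚ))
    (hsum : 1 ≤ countSum n 5 3 (cPrimeFat 5 3 5 1 f) E (fun s => (cntSeries 5 s (Cs.map Finset.card) : ℚ))) :
    LocalShadowHall M 5 G := by
  have hk' : kColoops M G + 5 = 5 + 1 := by omega
  have hd' : (gr M \ G).card ≤ 5 := by omega
  have hm2 : ∀ B ∈ thinMembers M 5 G, 5 ≤ (B \ coloops M G).card → 2 ≤ (G \ clF M B).card :=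
    fun B hB _ => two_le_card_sdiff_of_not_lay0 hG hd' (mem_thinMembers.1 hB).1 (mem_thinMembers.1 hB).2
  have hc2 : 0 ≤ cPrimeDGP 5 3 5 (kColoops M G) 2 := by
    rw [hk]; unfold cPrimeDGP capDG reqDGP phiQ; norm_num
  have hn' : G.card - kColoops M G = n := by omega
  have hKG : coloops M G ⊆ G := fun y hy => (mem_coloops.1 hy).1
  have hnK : (G \ coloops M G).card = n := by
    rw [Finset.card_sdiff_of_subset hKG, ← kColoops_eq_card_coloops]; omega
  have hcf' : 0 ≤ cPrimeFat 5 3 5 (kColoops M G) f := by rw [hk]; exact hcf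
  refine localShadowHall_excess_of_count_fat (d := 3) (ρ := 5) (m₁ := 2) (f := f) hG hd (by norm_num) hk'
    (by norm_num) hs hl hc2 hm2 hcf' hfat (E := E) hE ?_
    (cnt := fun s => (cntSeries 5 s (Cs.map Finset.card) : ℚ)) ?_ ?_ ?_
  · intro S _ T hT
    have hT' : T ∈ (S \ coloops M G).powersetCard 5 := by
      unfold coverBases at hT
      exact (Finset.mem_filter.1 hT).1
    have h := sum_faceLoss_union_le (a := a) (b := b) hG hd (by norm_num) hk' (by omega) hs hl hb
      (by rw [hnK]; exact hchord) (by rw [hnK, hk, hEeq]; exact hE.le) hT'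
    rw [hnK, hk, hEeq] at h
    exact h
  · intro s h1 h2
    rw [hn'] at h2
    exact hpos s h1 h2
  · intro S hSG
    exact card_coverBases_le_cntSeries hk' Cs hpw hsz hcoc hSG
  · rw [hn', hk]
    exact hsum

/-- The coloops avoid a pair of non-coloops. -/
theorem coloops_subset_sdiff_pair {G : Finset α} {a b : α} (ha : a ∉ coloops M G) (hb : b ∉ coloops M G) :
    coloops M G ⊆ G \ {a, b} := by
  intro z hz
  rw [Finset.mem_sdiff]
  refine ⟨(mem_coloops.1 hz).1, ?_⟩
  simp only [Finset.mem_insert, Finset.mem_singleton]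
  rintro (rfl | rfl)
  · exact ha hz
  · exact hb hz

omit [M.Finite] in
/-- The two orderings of a 2-cocircuit. -/
theorem pair_cocircuit {q : ℕ} {G : Finset α} {a b : α}
    (h : M.eRk ((G \ {a, b} : Finset α) : Set α) ≤ ((q : ℕ) : ℕ∞)) :
    ∀ c ∈ ({a, b} : Finset α), ∀ e ∈ ({a, b} : Finset α), c ≠ e →
      M.eRk ((G \ {c, e} : Finset α) : Set α) ≤ ((q : ℕ) : ℕ∞) := by
  intro c hc e he hce
  simp only [Finset.mem_insert, Finset.mem_singleton] at hc he
  rcases hc with rfl | rfl <;> rcases he with rfl | rfl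
  · exact absurd rfl hce
  · exact h
  · rwa [Finset.pair_comm]
  · exact absurd rfl hce

open scoped Classical in
/-- **The one-fat-closure cell of `(3, 1)` at `11 ≤ |G| ≤ 15`**: a fat 2-cocircuit `{p, x}` and at most one fat thin
closure give (LI_G) (`f = 1`, class `[2]`; count sums `1.118 … 3.055`). -/
theorem localShadowHall_three_one_five_of_onePair_fat {G : Finset α} (hG : G ∈ flatsQ M (5 + 1))
    (hd : (gr M \ G).card = 3) (hk : kColoops M G = 1)
    (hs : ∀ e ∈ gr M, ∀ f ∈ gr M, e ≠ f → rkN M {e, f} = 2) (hl : ∀ e ∈ gr M, M.Indep {e})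
    (hn1 : 11 ≤ G.card) (hn2 : G.card ≤ 15) (hcl : (fatClosures M 5 G 2).card ≤ 1) {p x : α} (hpx : p ≠ x)
    (hK : ∀ a ∈ ({p, x} : Finset α), a ∉ coloops M G)
    (hH₀ : M.eRk ((G \ {p, x} : Finset α) : Set α) ≤ ((5 : ℕ) : ℕ∞)) :
    LocalShadowHall M 5 G := by
  obtain ⟨a, b, E, hb, hchord, hEeq, hE, hsum, -, -⟩ := three_one_fat_data (G.card - 1) (by omega) (by omega)
  have hc₁ : ({p, x} : Finset α).card = 2 := Finset.card_pair hpx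
  refine localShadowHall_three_one_five_of_classes_fat hG hd hk hs hl (n := G.card - 1) (by omega)
    [({p, x} : Finset α)] (List.pairwise_singleton _ _) ?_ ?_ (f := 1) (by rw [cPrimeFat_three_one_one]; norm_num)
    ?_ hb hchord hEeq hE ?_ ?_
  · intro C hC
    rw [List.mem_singleton] at hC
    rw [hC, hc₁]; omega
  · intro C hC a ha b hb hab
    rw [List.mem_singleton] at hC
    rw [hC] at ha hb
    exact ⟨coloops_subset_sdiff_pair (hK a ha) (hK b hb), pair_cocircuit hH₀ a ha b hb hab⟩
  · intro S _ _
    exact (card_fat_coverPreimages_le_card_fatClosures (q := 5) (G := G) (S := S) 2).trans hcl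
  · simp only [List.map_cons, List.map_nil, hc₁]
    intro s h1 h2
    exact cntSeries_five_2_pos s h1 (by omega)
  · simp only [List.map_cons, List.map_nil, hc₁]
    exact hsum

open scoped Classical in
/-- **The two-disjoint-pairs cell of `(3, 1)` at `11 ≤ |G| ≤ 15`**: two fat 2-cocircuits with disjoint pairs and at
most two fat thin closures give (LI_G) (`f = 2`, class `[2, 2]`; count sums `1.087 … 2.235`). -/
theorem localShadowHall_three_one_five_of_twoDisjoint_fat {G : Finset α} (hG : G ∈ flatsQ M (5 + 1))
    (hd : (gr M \ G).card = 3) (hk : kColoops M G = 1)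
    (hs : ∀ e ∈ gr M, ∀ f ∈ gr M, e ≠ f → rkN M {e, f} = 2) (hl : ∀ e ∈ gr M, M.Indep {e})
    (hn1 : 11 ≤ G.card) (hn2 : G.card ≤ 15) (hcl : (fatClosures M 5 G 2).card ≤ 2) {p x u v : α}
    (hpx : p ≠ x) (huv : u ≠ v) (hdisj : Disjoint ({p, x} : Finset α) {u, v})
    (hK : ∀ a ∈ ({p, x, u, v} : Finset α), a ∉ coloops M G)
    (hH₀ : M.eRk ((G \ {p, x} : Finset α) : Set α) ≤ ((5 : ℕ) : ℕ∞))
    (hH₃ : M.eRk ((G \ {u, v} : Finset α) : Set α) ≤ ((5 : ℕ) : ℕ∞)) :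
    LocalShadowHall M 5 G := by
  obtain ⟨a, b, E, hb, hchord, hEeq, hE, -, hsum, -⟩ := three_one_fat_data (G.card - 1) (by omega) (by omega)
  have hc₁ : ({p, x} : Finset α).card = 2 := Finset.card_pair hpx
  have hc₂ : ({u, v} : Finset α).card = 2 := Finset.card_pair huv
  have hKP : ∀ a ∈ ({p, x} : Finset α), a ∉ coloops M G := by
    intro a ha; apply hK; simp only [Finset.mem_insert, Finset.mem_singleton] at ha ⊢; tauto
  have hKQ : ∀ a ∈ ({u, v} : Finset α), a ∉ coloops M G := by
    intro a ha; apply hK; simp only [Finset.mem_insert, Finset.mem_singleton] at ha ⊢; tauto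
  refine localShadowHall_three_one_five_of_classes_fat hG hd hk hs hl (n := G.card - 1) (by omega)
    [({p, x} : Finset α), {u, v}] ?_ ?_ ?_ (f := 2) (by rw [cPrimeFat_three_one_two]; norm_num)
    ?_ hb hchord hEeq hE ?_ ?_
  · rw [List.pairwise_cons]
    refine ⟨?_, List.pairwise_singleton _ _⟩
    intro C hC
    rw [List.mem_singleton] at hC
    rw [hC]; exact hdisj
  · intro C hC
    simp only [List.mem_cons, List.not_mem_nil, or_false] at hC
    rcases hC with rfl | rfl
    · rw [hc₁]; omega
    · rw [hc₂]; omega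
  · intro C hC a ha b hb hab
    simp only [List.mem_cons, List.not_mem_nil, or_false] at hC
    rcases hC with rfl | rfl
    · exact ⟨coloops_subset_sdiff_pair (hKP a ha) (hKP b hb), pair_cocircuit hH₀ a ha b hb hab⟩
    · exact ⟨coloops_subset_sdiff_pair (hKQ a ha) (hKQ b hb), pair_cocircuit hH₃ a ha b hb hab⟩
  · intro S _ _
    exact (card_fat_coverPreimages_le_card_fatClosures (q := 5) (G := G) (S := S) 2).trans hcl
  · simp only [List.map_cons, List.map_nil, hc₁, hc₂]
    intro s h1 h2
    exact cntSeries_five_22_pos s h1 (by omega)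
  · simp only [List.map_cons, List.map_nil, hc₁, hc₂]
    exact hsum

open scoped Classical in
/-- **The triangle cell of `(3, 1)` at `11 ≤ |G| ≤ 15`**: a triangle of 2-cocircuits `{p, x}, {p, y}, {x, y}` and at
most two fat thin covering preimages at every middle target give (LI_G) (`f = 2`, class `[3]`; count sums
`1.187 … 2.490`). -/
theorem localShadowHall_three_one_five_of_triangle_fat {G : Finset α} (hG : G ∈ flatsQ M (5 + 1))
    (hd : (gr M \ G).card = 3) (hk : kColoops M G = 1)
    (hs : ∀ e ∈ gr M, ∀ f ∈ gr M, e ≠ f → rkN M {e, f} = 2) (hl : ∀ e ∈ gr M, M.Indep {e})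
    (hn1 : 11 ≤ G.card) (hn2 : G.card ≤ 15)
    (hfat : ∀ S ∈ shadowAt M (5 + 2) 5 (Uq M (5 + 2) 5) G, 5 + 1 ≤ (S \ coloops M G).card →
      ((coverPreimages M (Uq M (5 + 2) 5) G S).filter
        (fun B => B ∉ lay0 M 5 G ∧ (G \ clF M B).card ≤ 2)).card ≤ 2)
    {p x y : α} (hpx : p ≠ x) (hpy : p ≠ y) (hxy : x ≠ y)
    (hK : ∀ a ∈ ({p, x, y} : Finset α), a ∉ coloops M G)
    (hH₀ : M.eRk ((G \ {p, x} : Finset α) : Set α) ≤ ((5 : ℕ) : ℕ∞))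
    (hH₁ : M.eRk ((G \ {p, y} : Finset α) : Set α) ≤ ((5 : ℕ) : ℕ∞))
    (hH₂ : M.eRk ((G \ {x, y} : Finset α) : Set α) ≤ ((5 : ℕ) : ℕ∞)) :
    LocalShadowHall M 5 G := by
  obtain ⟨a, b, E, hb, hchord, hEeq, hE, -, -, hsum⟩ := three_one_fat_data (G.card - 1) (by omega) (by omega)
  have hc3 : ({p, x, y} : Finset α).card = 3 := by
    rw [Finset.card_insert_of_notMem (by simp [hpx, hpy]), Finset.card_pair hxy]
  refine localShadowHall_three_one_five_of_classes_fat hG hd hk hs hl (n := G.card - 1) (by omega)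
    [({p, x, y} : Finset α)] (List.pairwise_singleton _ _) ?_ ?_ (f := 2)
    (by rw [cPrimeFat_three_one_two]; norm_num) hfat hb hchord hEeq hE ?_ ?_
  · intro C hC
    rw [List.mem_singleton] at hC
    rw [hC, hc3]; omega
  · intro C hC a ha b hb hab
    rw [List.mem_singleton] at hC
    rw [hC] at ha hb
    exact ⟨coloops_subset_sdiff_pair (hK a ha) (hK b hb), triangle_cocircuits hH₀ hH₁ hH₂ a ha b hb hab⟩
  · simp only [List.map_cons, List.map_nil, hc3]
    intro s h1 h2
    exact cntSeries_five_3_pos s h1 (by omega)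
  · simp only [List.map_cons, List.map_nil, hc3]
    exact hsum

end PercRepro.Shadow
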